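import Summits.QuantumFields.QCD.Theorems.PauliWegnerSeaOneScaleTrajectoryContentInLower
import Summits.QuantumFields.QCD.Theorems.WilsonMobilityGapMobilityGapCriticalMassOrder

/-!
# `PauliWegnerSea.OneScaleTrajectory` (stmt-QuantumFields-11513) — necessity: every witness lives in the `O(a_k)` supercritical window

Support file (prover pitem seat c4, `--supports stmt-QuantumFields-11513`).  Sorry-free, no new
definitions.  It transfers to the legacy support item `OneScaleTrajectory` the sharp necessity
window proved for the sibling crux `WilsonMobilityGap.MobilityGap`
(`Theorems/WilsonMobilityGapMobilityGapCriticalMassOrder.lean`): clause (iii) LOWER alone — through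
the configuration-wise `ℓ²` Neumann bound of the Wilson resolvent at positive bare mass, lattice rate
`log (1 + m/4)` — forces every realised bare mass and the flavour-blind critical mass of ANY witness
below `K a_k` eventually (`K = 8|C₁|/s` from the data of (iii)).  Together with
`oneScaleTrajectory_without_lower_holds` (the item minus (iii) holds outright, lattice-heavy witness)
this pins the whole content of the item to the LOWER bound (iii) at bare masses within `O(a_k)` of, or
below, the free critical point `κ = 1/8` — the region without background-uniform resolvent bounds.

* `oneScaleTrajectory_witness_order` — crux-level corollary for this item.
* `oneScaleTrajectory_witness_bare_window` — the two-sided window `-81/10 < m_f(k) ≤ K a_k`.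
-/

noncomputable section

namespace Summit.QuantumFields.QCD.Theorems.OneScaleTrajectoryContent

open scoped BigOperators Topology
open MeasureTheory Filter Set
open Literature.MathematicalPhysics.QuantumFieldTheory Literature.MathematicalPhysics.QuantumLattice
  Literature.Probability.LatticeModels
open Summit.QuantumFields.QCD.Theorems.MobilityGapNegative
open Summit.QuantumFields.QCD.Theorems.MobilityGapCriticalMassOrder
open Summit.QuantumFields.QCD.Theses.PauliWegnerSea (OneScaleTrajectory)

variable {Nf : ℕ}

/-- **Necessity window for `OneScaleTrajectory`.**  Every witness regularisation of the item has, for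
every positive mass tuple `m`, some `K ≥ 0` with all realised bare masses
`m_crit(k) + a_k m_f / Z_m(k) ≤ K a_k` eventually, and its critical mass satisfies `m_crit(k) ≤ K a_k`
eventually for some `K ≥ 0`: clause (iii) with data `(s, c₀, C₁, p)` is incompatible with a lattice
decay rate `s · log (1 + m_f(k)/4) > C₁ a_k` (`exists_bare_le_mul_a_of_lower`,
`exists_mcrit_le_mul_a_of_lower`). -/
theorem oneScaleTrajectory_witness_order :
    OneScaleTrajectory → ∀ Nf : ℕ, Nf = 2 ∨ Nf = 3 → ∃ reg : QCDRegularisation Nf,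
      reg.HasMassScaling ∧ (reg.scheme 0 0 0).HasAsymptoticScaling ∧
      (∀ m : Fin Nf → ℝ, (∀ f, 0 < m f) → Lower reg m ∧
        ∃ K : ℝ, 0 ≤ K ∧ ∀ f : Fin Nf, ∀ᶠ k in atTop,
          reg.mcrit k + reg.a k * m f / reg.Zm k ≤ K * reg.a k) ∧
      ∃ K : ℝ, 0 ≤ K ∧ ∀ᶠ k in atTop, reg.mcrit k ≤ K * reg.a k := by
  intro h Nf hNf
  obtain ⟨reg, hMS, hAS, hm⟩ := oneScaleTrajectory_iff_clauses.1 h Nf hNf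
  have hNf0 : 0 < Nf := by rcases hNf with rfl | rfl <;> norm_num
  refine ⟨reg, hMS, hAS, fun m hmpos => ?_, ?_⟩
  · have hL : Lower reg m := (hm m hmpos).2.2.1
    exact ⟨hL, exists_bare_le_mul_a_of_lower reg m hL⟩
  · exact exists_mcrit_le_mul_a_of_lower reg (fun _ => 1) (fun _ => one_pos) ⟨0, hNf0⟩
      (hm _ fun _ => one_pos).2.2.1

/-- **Two-sided bare window of any witness.**  For every positive mass tuple and flavour, eventually
`-81/10 < m_f(k)` (hopping window of `LowerPin`, from (iii)) and `m_f(k) ≤ K a_k` (Neumann disc):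
the trajectory is confined to `(-81/10, K a_k]`, i.e. to the supercritical side of `κ = 1/8` up to
`O(a_k)`, where the Wilson matrix is not background-uniformly invertible. -/
theorem oneScaleTrajectory_witness_bare_window :
    OneScaleTrajectory → ∀ Nf : ℕ, Nf = 2 ∨ Nf = 3 → ∃ reg : QCDRegularisation Nf,
      reg.HasMassScaling ∧ (reg.scheme 0 0 0).HasAsymptoticScaling ∧
      ∀ m : Fin Nf → ℝ, (∀ f, 0 < m f) → ∃ K : ℝ, 0 ≤ K ∧ ∀ f : Fin Nf, ∀ᶠ k in atTop,
        -(81 / 10 : ℝ) < reg.mcrit k + reg.a k * m f / reg.Zm k ∧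
          reg.mcrit k + reg.a k * m f / reg.Zm k ≤ K * reg.a k := by
  intro h Nf hNf
  obtain ⟨reg, hMS, hAS, hm, -⟩ := oneScaleTrajectory_witness_order h Nf hNf
  refine ⟨reg, hMS, hAS, fun m hmpos => ?_⟩
  obtain ⟨hL, K, hK, hb⟩ := hm m hmpos
  refine ⟨K, hK, fun f => ?_⟩
  filter_upwards [eventually_window_of_lower reg m hL f, hb f] with k hk hkb
  refine ⟨?_, hkb⟩
  have := (abs_lt.1 hk).1
  linarith

end Summit.QuantumFields.QCD.Theorems.OneScaleTrajectoryContent
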